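import Mathlib
import Summits.ValiantsHypothesis.ValiantsHypothesis.Theses.ValuativeGCT
import Summits.ValiantsHypothesis.ValiantsHypothesis.Theorems.ValuativeGCTCoeffVanishingOrder
import Literature.NumberTheory.DiophantineGeometry.SchurWeylPlethysmKroneckerBoundProofs
import Literature.NumberTheory.DiophantineGeometry.SchurWeylPlethysmOrbitWeightsProofs
import Literature.Computability.AlgebraicComplexity.MultiplicityObstructionsProofs
import Literature.Computability.AlgebraicComplexity.PlethysmLifting
import Literature.Computability.AlgebraicComplexity.OrbitCoordinateRingProofs

/-!
# `ValuativeGCT.ValuativeBound` (crux stmt-ValiantsHypothesis-12625) — the valuative bound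

`ValuativeBound_proof : Theses.ValuativeGCT.ValuativeBound`: for every `m ≥ 1`, every linear space
`U` of `m × m` matrices all of rank `≤ r`, every `δ` and every `λ ⊢ m δ` with at most `m²` parts, the
multiplicity `K_m(λ) = orbitMultiplicity ℂ (detFormLex ℂ m) m λ*` of `λ*` in `ℂ[Δ(det_m)]` is at most
`dim T_U(λ)`, the valuative truncation of the route (forms `G` on `End(ℂ^{m×m})`, homogeneous of
degree `m δ`, in `I(L_U)^(δ(m-r))`, invariant under `A ↦ A M` for every `M` with `det_m ∘ M = det_m`,
and `B`-semi-invariant of weight `λ*` under `G ↦ (A ↦ G(g⁻¹ A))`).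

Proof — the Φ-injection line (crux cards semisimple-lift-exact-rank / hwtopoly-*; this file is the
prover's port of Part I of the candidate `Cruxes/ValuativeBound/TRIAGE-r1-3-ValuativeBoundProof.lean`
by refuter-cruxtri-stmt-ValiantsHypothesis-12625-r1-3-g2, with Part II replaced by the landed support
theorem `CoeffVanishingOrder_proof`, stmt-12628):
* the tree's injection `hwToPoly (detFormLex ℂ m) m χ` embeds the weight-`χ` highest-weight space of
  `ℂ[Δ(det_m)]` into `ℂ[End W]` (the End-orbit pull-back `F ↦ (A ↦ F(det_m(x A)))`,
  `genericOrbitMap`, descended to the orbit-closure coordinate ring), so `K_m(λ) ≤ finrank T` as soon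
  as its range lies in `T` (`orbitMultiplicity_le_finrank_of_range_le`; `T` is finite-dimensional
  inside the homogeneous piece);
* a highest-weight CLASS lifts to an honest highest-weight VECTOR `F` of `ℂ[Sym^m]` (complete
  reducibility of `coordRep`, `highestWeightClassLifts`), and for `F` the four clauses of `T` are
  identities: degree `m δ` (`degree_clause`, the weight pins the degree; this consumes
  `λ.parts.card ≤ m²`), membership in `I(L_U)^(δ(m-r))` (every coefficient of `det_m(x A)` lies in
  `I(L_U)^(m-r)` — `CoeffVanishingOrder_proof` — and an algebra map sending variables into `J` sends
  degree-`δ` forms into `J^δ`, `aeval_mem_pow_of_isHomogeneous`), invariance under every `M` with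
  `det_m ∘ M = det_m` (`stab_clause_poly`), and `B`-semi-invariance with the character `weightChar χ g`
  (`borel_clause_poly`, from `eval_orbitCoordToPoly_mul_left` by `GL`-density).
Hüttenhain 2017 (arXiv:1512.04352) Thm 4 is the conceptual source (`ℂ[Nor Δ] ↪ ℂ[End W]^Stab`);
BLMW 2011 (arXiv:0907.2850) Prop. 5.2.1 is the case `U = 0`. [folklore plumbing over the tree]
-/

-- `Summit.ValiantsHypothesis.ValiantsHypothesis.…` is the tree's mandated single-conjunct layout (Sub = Summit).
set_option linter.dupNamespace false

namespace Summit.ValiantsHypothesis.ValiantsHypothesis.Theorems.ValuativeBound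

open MvPolynomial
open scoped Matrix BigOperators
open Literature.NumberTheory.DiophantineGeometry Literature.Computability.AlgebraicComplexity

noncomputable section

/-! ## §1 Glue: range of `hwToPoly` inside `T` bounds the multiplicity -/

/-- Evaluating an `aeval`-substitution by polynomials is evaluating at the evaluated substitution
(`aeval_eq_bind₁` + `eval₂Hom_bind₁`). [folklore] -/
theorem eval_aeval_poly {σ' τ : Type*} (A : τ → ℂ) (h : σ' → MvPolynomial τ ℂ)
    (φ : MvPolynomial σ' ℂ) :
    eval A (aeval h φ) = eval (fun i => eval A (h i)) φ := by
  rw [aeval_eq_bind₁]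
  exact eval₂Hom_bind₁ _ _ _ _

/-- Glue: an inclusion of the range of the tree's injection `hwToPoly (detFormLex ℂ m) m χ` into any
subspace `T` of a homogeneous piece bounds `K_m(χ)` by `finrank T` (no `finrank` junk: `T` is
finite-dimensional). BLMW 2011 §5.2. [folklore] -/
theorem orbitMultiplicity_le_finrank_of_range_le {m : ℕ} (χ : Weight (MatIdx m)) (n : ℕ)
    (T : Submodule ℂ (MvPolynomial (MatIdx m × MatIdx m) ℂ))
    (hT : T ≤ homogeneousSubmodule (MatIdx m × MatIdx m) ℂ n)
    (hrange : LinearMap.range (hwToPoly (detFormLex ℂ m) m χ) ≤ T) :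
    orbitMultiplicity ℂ (detFormLex ℂ m) m χ ≤ Module.finrank ℂ T := by
  haveI : Module.Finite ℂ (homogeneousSubmodule (MatIdx m × MatIdx m) ℂ n) :=
    Literature.Computability.AlgebraicComplexity.finite_homogeneousSubmodule _ _ n
  haveI : Module.Finite ℂ T := Submodule.finiteDimensional_of_le hT
  calc orbitMultiplicity ℂ (detFormLex ℂ m) m χ
        = Module.finrank ℂ (highestWeightSpace (orbitCoordRep (detFormLex ℂ m) m) χ) := rfl
    _ = Module.finrank ℂ (LinearMap.range (hwToPoly (detFormLex ℂ m) m χ)) :=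
        (LinearMap.finrank_range_of_inj (hwToPoly_injective _ _ _)).symm
    _ ≤ Module.finrank ℂ T := Submodule.finrank_mono hrange

/-! ## §2 The four clauses of the truncation for a lifted highest-weight vector -/

/-- Borel sign: for a highest-weight class of weight `χ` and upper triangular `g`,
`P(g⁻¹ g') = weightChar χ g · P(g')` for the attached polynomial `P` on `End W` — the character,
not its inverse, exactly as the route's `B`-clause is typed (`eval_orbitCoordToPoly_mul_left` at
`g⁻¹` and `weightChar_inv`). Goodman–Wallach §3.2.1. [folklore] -/
theorem borel_sign {m : ℕ} {F : MvPolynomial (DegIdx (MatIdx m) m) ℂ} {χ : Weight (MatIdx m)}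
    (hx : Ideal.Quotient.mk (orbitVanishingIdeal (detFormLex ℂ m) m) F ∈
      highestWeightSpace (orbitCoordRep (detFormLex ℂ m) m) χ)
    {g : GL (MatIdx m) ℂ} (hg : IsUpperTriangular g) (g' : GL (MatIdx m) ℂ) :
    eval (fun ij : MatIdx m × MatIdx m =>
        (((g⁻¹ : GL (MatIdx m) ℂ) : Matrix (MatIdx m) (MatIdx m) ℂ) *
          (g' : Matrix (MatIdx m) (MatIdx m) ℂ)) ij.1 ij.2)
        (orbitCoordToPoly (detFormLex ℂ m) m
          (Ideal.Quotient.mk (orbitVanishingIdeal (detFormLex ℂ m) m) F)) =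
      weightChar χ g *
        eval (fun ij : MatIdx m × MatIdx m => (g' : Matrix (MatIdx m) (MatIdx m) ℂ) ij.1 ij.2)
          (orbitCoordToPoly (detFormLex ℂ m) m
            (Ideal.Quotient.mk (orbitVanishingIdeal (detFormLex ℂ m) m) F)) := by
  have h := eval_orbitCoordToPoly_mul_left (detFormLex ℂ m) m hx ((borelSubgroup _ _).inv_mem hg) g'
  rwa [weightChar_inv χ hg, inv_inv] at h

/-- The route's Borel clause as a POLYNOMIAL identity: substituting `A ↦ g⁻¹ A` in the polynomial
attached to a weight-`χ` highest-weight class multiplies it by `weightChar χ g`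
(`borel_sign` upgraded by `GL`-density, `MvPolynomial.eq_of_eval_eq_on_gl`). [folklore] -/
theorem borel_clause_poly {m : ℕ} {F : MvPolynomial (DegIdx (MatIdx m) m) ℂ} {χ : Weight (MatIdx m)}
    (hx : Ideal.Quotient.mk (orbitVanishingIdeal (detFormLex ℂ m) m) F ∈
      highestWeightSpace (orbitCoordRep (detFormLex ℂ m) m) χ)
    {g : GL (MatIdx m) ℂ} (hg : IsUpperTriangular g) :
    aeval (R := ℂ) (fun p : MatIdx m × MatIdx m =>
        ∑ l : MatIdx m, ((g⁻¹ : GL (MatIdx m) ℂ) : Matrix (MatIdx m) (MatIdx m) ℂ) p.1 l • X (l, p.2))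
        (orbitCoordToPoly (detFormLex ℂ m) m
          (Ideal.Quotient.mk (orbitVanishingIdeal (detFormLex ℂ m) m) F)) =
      weightChar χ g •
        orbitCoordToPoly (detFormLex ℂ m) m
          (Ideal.Quotient.mk (orbitVanishingIdeal (detFormLex ℂ m) m) F) := by
  apply MvPolynomial.eq_of_eval_eq_on_gl
  intro g'
  have hfun : (fun i : MatIdx m × MatIdx m =>
      eval (fun ij : MatIdx m × MatIdx m => (g' : Matrix (MatIdx m) (MatIdx m) ℂ) ij.1 ij.2)
        (∑ l : MatIdx m, ((g⁻¹ : GL (MatIdx m) ℂ) : Matrix (MatIdx m) (MatIdx m) ℂ) i.1 l •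
          X (l, i.2))) =
      fun ij => (((g⁻¹ : GL (MatIdx m) ℂ) : Matrix (MatIdx m) (MatIdx m) ℂ) *
        (g' : Matrix (MatIdx m) (MatIdx m) ℂ)) ij.1 ij.2 := by
    funext ij
    simp [Matrix.mul_apply, smul_eval]
  rw [smul_eval, ← borel_sign hx hg g', eval_aeval_poly, hfun]

/-- The route's stabiliser clause, for EVERY matrix `M` with `det_m ∘ M = det_m` (invertible or not),
at the level of the generic End-orbit pull-back: `(A ↦ Φ F (A M)) = Φ F` as polynomials, by
`eval_genericOrbitMap` and `linSubst_mul`. Mulmuley–Sohoni 2001 §4. [folklore] -/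
theorem stab_clause_poly {m : ℕ} (F : MvPolynomial (DegIdx (MatIdx m) m) ℂ)
    {M : Matrix (MatIdx m) (MatIdx m) ℂ}
    (hM : linSubst (MatIdx m) ℂ M (detFormLex ℂ m) = detFormLex ℂ m) :
    aeval (R := ℂ) (fun p : MatIdx m × MatIdx m => ∑ l : MatIdx m, M l p.2 • X (p.1, l))
        (genericOrbitMap (detFormLex ℂ m) m F) = genericOrbitMap (detFormLex ℂ m) m F := by
  apply MvPolynomial.funext
  intro A
  rw [eval_aeval_poly]
  have hA : (fun ij : MatIdx m × MatIdx m => eval A (∑ l : MatIdx m, M l ij.2 • X (ij.1, l))) =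
      fun ij => ((Matrix.of fun i j => A (i, j)) * M) ij.1 ij.2 := by
    funext ij
    simp [Matrix.mul_apply, smul_eval, mul_comm]
  rw [hA, eval_genericOrbitMap, linSubst_mul, AlgHom.comp_apply, hM,
    ← eval_genericOrbitMap]
  rfl

/-- Semisimple lift: highest-weight CLASSES of `ℂ[Δ_m[f]]` are classes of honest highest-weight
VECTORS of `ℂ[Sym^m]` (complete reducibility of `coordRep`,
`map_highestWeightSpace_eq_of_surjective`). BLMW 2011 §4.4. [folklore] -/
theorem highestWeightClassLifts {σ : Type} [Fintype σ] [LinearOrder σ] (f : MvPolynomial σ ℂ)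
    (m : ℕ) (χ : Weight σ) :
    (highestWeightSpace (coordRep σ ℂ m) χ).map
        (Ideal.Quotient.mkₐ ℂ (orbitVanishingIdeal f m)).toLinearMap =
      highestWeightSpace (orbitCoordRep f m) χ := by
  let π : (coordRep σ ℂ m).IntertwiningMap (orbitCoordRep f m) :=
    ⟨(Ideal.Quotient.mkₐ ℂ (orbitVanishingIdeal f m)).toLinearMap, fun _ => LinearMap.ext fun _ => rfl⟩
  exact map_highestWeightSpace_eq_of_surjective π (Ideal.Quotient.mkₐ_surjective ℂ _)
    (isSemisimpleRepresentation_coordRep m) χ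

/-- Degree clause: the polynomial attached to a weight-`λ*` class is homogeneous of degree `m δ`
(the weight pins the degree, `isHomogeneous_orbitCoordToPoly` with
`size_toMatIdx_dualOfPartition`; this is where `λ.parts.card ≤ m²` is consumed). BLMW 2011 §4.4.
[folklore] -/
theorem degree_clause {m δ : ℕ} (lam : Nat.Partition (m * δ)) (hlam : lam.parts.card ≤ m * m)
    {F : MvPolynomial (DegIdx (MatIdx m) m) ℂ}
    (hx : Ideal.Quotient.mk (orbitVanishingIdeal (detFormLex ℂ m) m) F ∈
      highestWeightSpace (orbitCoordRep (detFormLex ℂ m) m)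
        ((Weight.dualOfPartition (m * m) lam).toMatIdx : Weight (MatIdx m))) :
    orbitCoordToPoly (detFormLex ℂ m) m (Ideal.Quotient.mk (orbitVanishingIdeal (detFormLex ℂ m) m) F) ∈
      homogeneousSubmodule (MatIdx m × MatIdx m) ℂ (m * δ) :=
  (mem_homogeneousSubmodule _ _).mpr
    (isHomogeneous_orbitCoordToPoly _ m hx (size_toMatIdx_dualOfPartition m lam hlam))

/-- Generators-to-powers: an algebra map sending every variable into an ideal `J` sends a
homogeneous polynomial of degree `δ` into `J ^ δ`. [folklore] -/
theorem aeval_mem_pow_of_isHomogeneous {ι τ : Type*} (Φ : MvPolynomial ι ℂ →ₐ[ℂ] MvPolynomial τ ℂ)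
    (J : Ideal (MvPolynomial τ ℂ)) (hJ : ∀ d, Φ (X d) ∈ J) {F : MvPolynomial ι ℂ} {δ : ℕ}
    (hF : F.IsHomogeneous δ) : Φ F ∈ J ^ δ := by
  classical
  rw [F.as_sum, map_sum]
  refine Ideal.sum_mem _ fun s hs => ?_
  have hdeg : (∑ d ∈ s.support, s d) = δ := by
    have h := hF (mem_support_iff.mp hs)
    simpa [Finsupp.weight_apply, Finsupp.sum] using h
  rw [monomial_eq, map_mul]
  refine Ideal.mul_mem_left _ _ ?_
  rw [Finsupp.prod, map_prod, ← hdeg, ← Finset.prod_pow_eq_pow_sum]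
  refine Ideal.prod_mem_prod fun d _ => ?_
  rw [map_pow]
  exact Ideal.pow_mem_pow (hJ d) _

/-! ## §3 The crux -/

/-- **`CoeffVanishingOrder → ValuativeBound`** (the Φ-injection line end to end): lift a
highest-weight class to a highest-weight vector `F` (`highestWeightClassLifts`), push it through the
generic End-orbit pull-back, and check the four clauses of `T` (`degree_clause`;
`aeval_mem_pow_of_isHomogeneous` over the valuative estimate; `stab_clause_poly`;
`borel_clause_poly`); conclude by `orbitMultiplicity_le_finrank_of_range_le`. [folklore] -/
theorem valuativeBound_of_coeffVanishingOrder
    (hC : Summit.ValiantsHypothesis.ValiantsHypothesis.Theses.ValuativeGCT.CoeffVanishingOrder) :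
    Summit.ValiantsHypothesis.ValiantsHypothesis.Theses.ValuativeGCT.ValuativeBound := by
  intro m _ U r hU δ lam hlam
  dsimp only
  refine orbitMultiplicity_le_finrank_of_range_le _ (m * δ) _ (fun _ hx => hx.1.1.1) ?_
  rintro P ⟨x, rfl⟩
  -- lift the class `x` to an honest highest-weight vector `F`
  have hxmap : (x : OrbitCoordRing (detFormLex ℂ m) m) ∈
      (highestWeightSpace (coordRep (MatIdx m) ℂ m)
          ((Weight.dualOfPartition (m * m) lam).toMatIdx : Weight (MatIdx m))).map
        (Ideal.Quotient.mkₐ ℂ (orbitVanishingIdeal (detFormLex ℂ m) m)).toLinearMap := by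
    rw [highestWeightClassLifts]; exact x.2
  obtain ⟨F, hF, hFx⟩ := hxmap
  have hFx' : Ideal.Quotient.mk (orbitVanishingIdeal (detFormLex ℂ m) m) F =
      (x : OrbitCoordRing (detFormLex ℂ m) m) := hFx
  have hxF : Ideal.Quotient.mk (orbitVanishingIdeal (detFormLex ℂ m) m) F ∈
      highestWeightSpace (orbitCoordRep (detFormLex ℂ m) m)
        ((Weight.dualOfPartition (m * m) lam).toMatIdx : Weight (MatIdx m)) := by
    rw [hFx']; exact x.2
  have hP : hwToPoly (detFormLex ℂ m) m
        ((Weight.dualOfPartition (m * m) lam).toMatIdx : Weight (MatIdx m)) x =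
      genericOrbitMap (detFormLex ℂ m) m F := by
    rw [hwToPoly_apply, ← hFx', orbitCoordToPoly_mk]
  rw [hP]
  -- the four clauses
  have hT1 : genericOrbitMap (detFormLex ℂ m) m F ∈
      homogeneousSubmodule (MatIdx m × MatIdx m) ℂ (m * δ) := by
    have h := degree_clause lam hlam hxF
    rwa [orbitCoordToPoly_mk] at h
  have hJ : ∀ d : DegIdx (MatIdx m) m, genericOrbitMap (detFormLex ℂ m) m (X d) ∈
      (MvPolynomial.vanishingIdeal ℂ
        {p : MatIdx m × MatIdx m → ℂ | ∀ j : MatIdx m, (fun i => p (j, i)) ∈ U}) ^ (m - r) :=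
    fun d => hC m U r hU d
  have hFhom : F.IsHomogeneous δ :=
    isHomogeneous_of_mem_highestWeightSpace (NeZero.ne m) hF
      (size_toMatIdx_dualOfPartition m lam hlam)
  have hT2 : genericOrbitMap (detFormLex ℂ m) m F ∈
      (MvPolynomial.vanishingIdeal ℂ
        {p : MatIdx m × MatIdx m → ℂ | ∀ j : MatIdx m, (fun i => p (j, i)) ∈ U}) ^ (δ * (m - r)) := by
    have h := aeval_mem_pow_of_isHomogeneous (genericOrbitMap (detFormLex ℂ m) m) _ hJ hFhom
    rwa [← pow_mul, mul_comm] at h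
  refine Submodule.mem_inf.mpr ⟨Submodule.mem_inf.mpr ⟨Submodule.mem_inf.mpr ⟨hT1, ?_⟩, ?_⟩, ?_⟩
  · exact hT2
  · simp only [Submodule.mem_iInf, LinearMap.mem_ker, LinearMap.sub_apply, LinearMap.id_apply,
      AlgHom.toLinearMap_apply, sub_eq_zero]
    intro M hM
    exact stab_clause_poly F hM
  · simp only [Submodule.mem_iInf, LinearMap.mem_ker, LinearMap.sub_apply, LinearMap.smul_apply,
      LinearMap.id_apply, AlgHom.toLinearMap_apply, sub_eq_zero]
    intro g hg
    have h := borel_clause_poly hxF hg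
    rwa [orbitCoordToPoly_mk] at h

/-- **`ValuativeBound` holds** (crux stmt-ValiantsHypothesis-12625 of route ValuativeGCT): for every
`m ≥ 1`, every linear space `U` of `m × m` matrices all of rank `≤ r`, every `δ` and every
`λ ⊢ m δ` with at most `m²` parts, `K_m(λ) ≤ dim T_U(λ)`. The Φ-injection
(`valuativeBound_of_coeffVanishingOrder`) over the landed valuative estimate
`CoeffVanishingOrder_proof` (stmt-12628). New (route-coined) inequality; `U = 0` is BLMW 2011
Prop. 5.2.1. [folklore plumbing] -/
theorem ValuativeBound_proof :
    Summit.ValiantsHypothesis.ValiantsHypothesis.Theses.ValuativeGCT.ValuativeBound :=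
  valuativeBound_of_coeffVanishingOrder
    Summit.ValiantsHypothesis.ValiantsHypothesis.Theorems.CoeffVanishingOrder.CoeffVanishingOrder_proof

end

end Summit.ValiantsHypothesis.ValiantsHypothesis.Theorems.ValuativeBound
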